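import Mathlib
import Summits.Ventures.PercRepro2.Defs
import Summits.Ventures.PercRepro2.Independence
import Summits.Ventures.PercRepro2.Harris
import Summits.Ventures.PercRepro2.Graph
import Summits.Ventures.PercRepro2.Exploration
import Summits.Ventures.PercRepro2.Events
import Summits.Ventures.PercRepro2.FourFunctions
import Summits.Ventures.PercRepro2.Induced
import Summits.Ventures.PercRepro2.Frontier
import Summits.Ventures.PercRepro2.ObsIndependence
import Summits.Ventures.PercRepro2.BHK
import Summits.Ventures.PercRepro2.BHKEvents
import Summits.Ventures.PercRepro2.SideAgreement
import Summits.Ventures.PercRepro2.VdBKahn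
import Summits.Ventures.PercRepro2.BHKAvoid
import Summits.Ventures.PercRepro2.R2PrimeThreeReduction
import Summits.Ventures.PercRepro2.YBridge
import Summits.Ventures.PercRepro2.Yu1Functionals
import Summits.Ventures.PercRepro2.Yu1Events
import Summits.Ventures.PercRepro2.Yu1
import Summits.Ventures.PercRepro2.LBSplit
import Summits.Ventures.PercRepro2.YDelta
import Summits.Ventures.PercRepro2.SD
import Summits.Ventures.PercRepro2.Threshold
import Summits.Ventures.PercRepro2.Lambda
import Summits.Ventures.PercRepro2.LambdaTau
import Summits.Ventures.PercRepro2.LambdaSlack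
import Summits.Ventures.PercRepro2.HF2
import Summits.Ventures.PercRepro2.Yu2
import Summits.Ventures.PercRepro2.N0
import Summits.Ventures.PercRepro2.Y
import Summits.Ventures.PercRepro2.YDeltaTools
import Summits.Ventures.PercRepro2.ZDelta
import Summits.Ventures.PercRepro2.ZExpand
import Summits.Ventures.PercRepro2.ISplit
import Summits.Ventures.PercRepro2.MRl
import Summits.Ventures.PercRepro2.ZOloc
import Summits.Ventures.PercRepro2.SideBridge
import Summits.Ventures.PercRepro2.HCov
import Summits.Ventures.PercRepro2.HCovFns
import Summits.Ventures.PercRepro2.HCovSwap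
import Summits.Ventures.PercRepro2.BasePrime
import Summits.Ventures.PercRepro2.PendantRoot
import Summits.Ventures.PercRepro2.PendantO
import Summits.Ventures.PercRepro2.PendantB
import Summits.Ventures.PercRepro2.PendantBRow
import Summits.Ventures.PercRepro2.LeafStep
import Summits.Ventures.PercRepro2.LeafStepT0

/-!
# The leaf row propagates along pendant paths (blind cell PercRepro2, p1 g7;
`proofs/P1-LEAFSTEP.md` §4)

If `v` is a leaf attached by the edge `g` (weight `r = p g`) to ANY vertex `w`, the leaf row at `v`
is LINEAR in `r`: **`R½(v) = (1 − r)·T₀ + r·R½(w)`** (`Rhalf_leaf_eq`; at `r = 0` the vertex `v` is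
isolated and the row is `T₀`, at `r = 1` it is glued to `w`). Hence `LeafRow` propagates from `w` to
`v` (`leafRow_of_leaf`), and together with the leaf expansion `Gc_leaf` at `v` so does (HCOV):
**`HCov_pendant_path`**: for `a₃` a leaf at `v` and `v` a leaf at `w`, (HCOV) at the marker `w` and
the leaf row at `w` give (HCOV) at `a₃`. Iterating along a pendant path `a₃ – v₁ – … – v_k – x`
reduces (HCOV) to the pair «(HCOV) ∧ 2′LEAF» at the attachment vertex `x` of the path; at a marked
`x` both are theorems (paper: `P1-LEAFSTEP.md` §4, certificates `path2.py`).
-/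

namespace Summit.Ventures.PercRepro2

open UnionCluster CovForm PendantRoot PendantO

namespace LeafStep

variable {V : Type*} {E : Type*} [Fintype E] [DecidableEq E] [Fintype V] [DecidableEq V]
  {R : Type*} [Field R] [LinearOrder R] [IsStrictOrderedRing R]

variable (p : E → R) (ends : E → Sym2 V)

omit [Fintype V] [DecidableEq V] [LinearOrder R] [IsStrictOrderedRing R] in
/-- `P(Q ∩ {v ∈ C₁}) = r · P(Q ∩ {w ∈ C₁})` for a leaf `v` at `w`. -/
lemma prob_Q_conn₁_leaf {g : E} {v w : V} (hg : ends g = s(v, w))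
    (hleaf : ∀ e, v ∈ ends e → e = g) (hvw : v ≠ w) {a₁ a₂ : V} (hv1 : v ≠ a₁) (hv2 : v ≠ a₂) :
    prob p (avoidAll ends a₂ {a₁} ∩ connEvent ends a₁ v) =
      p g * prob p (avoidAll ends a₂ {a₁} ∩ connEvent ends a₁ w) := by
  rw [← prob_T'_v, prob_T'_o p hg hleaf hvw hv1 hv2]

omit [Fintype V] [DecidableEq V] [LinearOrder R] [IsStrictOrderedRing R] in
/-- `P(Q ∩ {v ∈ C₂}) = r · P(Q ∩ {w ∈ C₂})` for a leaf `v` at `w`. -/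
lemma prob_Q_conn₂_leaf {g : E} {v w : V} (hg : ends g = s(v, w))
    (hleaf : ∀ e, v ∈ ends e → e = g) (hvw : v ≠ w) {a₁ a₂ : V} (hv1 : v ≠ a₁) (hv2 : v ≠ a₂) :
    prob p (avoidAll ends a₂ {a₁} ∩ connEvent ends a₂ v) =
      p g * prob p (avoidAll ends a₂ {a₁} ∩ connEvent ends a₂ w) := by
  rw [← prob_T_v, prob_T_o p hg hleaf hvw hv1 hv2]

omit [Fintype V] in
/-- **The chain identity**: for `v` a leaf at `w` through `g` (`r = p g`),
`R½(v) = (1 − r)·T₀ + r·R½(w)`. -/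
theorem Rhalf_leaf_eq {g : E} {v w : V} (hg : ends g = s(v, w)) (hleaf : ∀ e, v ∈ ends e → e = g)
    (hvw : v ≠ w) {o a₁ a₂ b : V} (hv1 : v ≠ a₁) (hv2 : v ≠ a₂) (ho : o ≠ v) (hb : b ≠ v) :
    Rhalf p ends o a₁ a₂ v b =
      (1 - p g) * T0 p ends o a₁ a₂ b + p g * Rhalf p ends o a₁ a₂ w b := by
  have c₁o := free_connEvent hg hleaf hvw (Ne.symm hv1) ho
  have c₂o := free_connEvent hg hleaf hvw (Ne.symm hv2) ho
  have c₁b := free_connEvent hg hleaf hvw (Ne.symm hv1) hb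
  have c₂b := free_connEvent hg hleaf hvw (Ne.symm hv2) hb
  unfold Rhalf T0 Gc1 mU mUU
  unfold EQbo EQb3 EQb3o EQo EQ3 EQ3o PDb PDbo Do
  rw [gap_eq_Q]
  simp only [prob_Q_conn₁_leaf p ends hg hleaf hvw hv1 hv2, prob_Q_conn₂_leaf p ends hg hleaf hvw hv1 hv2,
    prob_T_o p hg hleaf hvw hv1 hv2, prob_T'_o p hg hleaf hvw hv1 hv2,
    prob_PD_inter_o p hg hleaf hvw hv1 hv2 c₁b, prob_PD_inter_o p hg hleaf hvw hv1 hv2 c₂b,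
    prob_PD_inter_o p hg hleaf hvw hv1 hv2 c₁o, prob_PD_inter_o p hg hleaf hvw hv1 hv2 c₂o,
    prob_PD_inter_o p hg hleaf hvw hv1 hv2 (c₁o.inter c₁b),
    prob_PD_inter_o p hg hleaf hvw hv1 hv2 (c₂o.inter c₁b),
    prob_PD_inter_o p hg hleaf hvw hv1 hv2 (c₁o.inter c₂b),
    prob_PD_inter_o p hg hleaf hvw hv1 hv2 (c₂o.inter c₂b),
    prob_T_inter_o p hg hleaf hvw hv1 hv2 c₁b, prob_T_inter_o p hg hleaf hvw hv1 hv2 c₂b,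
    prob_T_inter_o p hg hleaf hvw hv1 hv2 c₁o, prob_T_inter_o p hg hleaf hvw hv1 hv2 c₂o,
    prob_T_inter_o p hg hleaf hvw hv1 hv2 (c₁o.inter c₁b),
    prob_T_inter_o p hg hleaf hvw hv1 hv2 (c₂o.inter c₁b),
    prob_T_inter_o p hg hleaf hvw hv1 hv2 (c₁o.inter c₂b),
    prob_T_inter_o p hg hleaf hvw hv1 hv2 (c₂o.inter c₂b),
    prob_T'_inter_o p hg hleaf hvw hv1 hv2 c₁b, prob_T'_inter_o p hg hleaf hvw hv1 hv2 c₂b,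
    prob_T'_inter_o p hg hleaf hvw hv1 hv2 c₁o, prob_T'_inter_o p hg hleaf hvw hv1 hv2 c₂o,
    prob_T'_inter_o p hg hleaf hvw hv1 hv2 (c₁o.inter c₁b),
    prob_T'_inter_o p hg hleaf hvw hv1 hv2 (c₂o.inter c₁b),
    prob_T'_inter_o p hg hleaf hvw hv1 hv2 (c₁o.inter c₂b),
    prob_T'_inter_o p hg hleaf hvw hv1 hv2 (c₂o.inter c₂b),
    prob_T_v p ends a₁ a₂ w, prob_T'_v p ends a₁ a₂ w,
    prob_PD_inter_v p ends a₁ a₂ w, prob_T_inter_v p ends a₁ a₂ w, prob_T'_inter_v p ends a₁ a₂ w]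
  ring

/-- **The leaf row propagates down a pendant edge**: `LeafRow` at `w` gives `LeafRow` at a leaf `v`
attached to `w`. -/
theorem leafRow_of_leaf (hp : IsProbVec p) {g : E} {v w : V} (hg : ends g = s(v, w))
    (hleaf : ∀ e, v ∈ ends e → e = g) (hvw : v ≠ w) {o a₁ a₂ b : V} (hv1 : v ≠ a₁) (hv2 : v ≠ a₂)
    (ho : o ≠ v) (hb : b ≠ v) (hw : LeafRow p ends o a₁ a₂ w b) : LeafRow p ends o a₁ a₂ v b := by
  unfold LeafRow at hw ⊢
  rw [Rhalf_leaf_eq p ends hg hleaf hvw hv1 hv2 ho hb]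
  have h1q : 0 ≤ 1 - p g := sub_nonneg.2 (hp.le_one g)
  exact add_nonneg (mul_nonneg h1q (T0_nonneg p ends hp o a₁ a₂ b)) (mul_nonneg (hp.nonneg g) hw)

/-- **(HCOV) propagates down a pendant edge**: (HCOV) and the leaf row at `w` give (HCOV) at a leaf
`v` attached to `w` (the leaf expansion `Gc_leaf` with `a₃ := v`). -/
theorem HCov_of_leaf (hp : IsProbVec p) {g : E} {v w : V} (hg : ends g = s(v, w))
    (hleaf : ∀ e, v ∈ ends e → e = g) (hvw : v ≠ w) {o a₁ a₂ b : V} (hv1 : v ≠ a₁) (hv2 : v ≠ a₂)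
    (ho : o ≠ v) (hb : b ≠ v) (hHw : HCov p ends o a₁ a₂ w b) (hRw : LeafRow p ends o a₁ a₂ w b) :
    HCov p ends o a₁ a₂ v b :=
  HCov_leaf p ends hp hg hleaf hvw hv1 hv2 ho hb hHw hRw

/-- **(HCOV) at the end of a pendant path of length two**: `a₃` a leaf at `v`, `v` a leaf at `w`;
(HCOV) and the leaf row at the attachment vertex `w` give (HCOV) at `a₃` (and the leaf row at `v`,
so the step can be iterated along any pendant path). -/
theorem HCov_pendant_path (hp : IsProbVec p) {f g : E} {a₃ v w : V} (hf : ends f = s(a₃, v))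
    (hleaf₃ : ∀ e, a₃ ∈ ends e → e = f) (h3v : a₃ ≠ v) (hg : ends g = s(v, w))
    (hleafv : ∀ e, v ∈ ends e → e = g) (hvw : v ≠ w) {o a₁ a₂ b : V} (h31 : a₃ ≠ a₁)
    (h32 : a₃ ≠ a₂) (ho3 : o ≠ a₃) (hb3 : b ≠ a₃) (hv1 : v ≠ a₁) (hv2 : v ≠ a₂) (hov : o ≠ v)
    (hbv : b ≠ v) (hHw : HCov p ends o a₁ a₂ w b) (hRw : LeafRow p ends o a₁ a₂ w b) :
    HCov p ends o a₁ a₂ a₃ b ∧ LeafRow p ends o a₁ a₂ v b := by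
  have hRv := leafRow_of_leaf p ends hp hg hleafv hvw hv1 hv2 hov hbv hRw
  have hHv := HCov_of_leaf p ends hp hg hleafv hvw hv1 hv2 hov hbv hHw hRw
  exact ⟨HCov_leaf p ends hp hf hleaf₃ h3v h31 h32 ho3 hb3 hHv hRv, hRv⟩

end LeafStep

end Summit.Ventures.PercRepro2
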